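import Mathlib
import Summits.Ventures.PercRepro2.Defs
import Summits.Ventures.PercRepro2.Independence
import Summits.Ventures.PercRepro2.Harris
import Summits.Ventures.PercRepro2.Graph
import Summits.Ventures.PercRepro2.Events
import Summits.Ventures.PercRepro2.GateCylinder
import Summits.Ventures.PercRepro2.CDNestedInternal
import Summits.Ventures.PercRepro2.CDNestedRoutes
import Summits.Ventures.PercRepro2.CDNestedFan
import Summits.Ventures.PercRepro2.CDNestedPaths

/-!
# THE NESTED-PATHS THEOREM: row 2′CD whenever the simple `a₁–a₃` paths avoiding `a₂` are pairwise
comparable (blind cell PercRepro2, mine-a g35; MINE-A.md §90.6, proofs/MINEA-CD-NESTED.md §5)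

The class NEST with NO route data at all.  In a finite simple graph (`ends` injective) with marks
`a₁, a₂, a₃`, suppose any two simple `a₁–a₃` paths avoiding `a₂` have comparable vertex sets
(`hchain`).  Then row 2′CD holds for every `o`, every up-set and every admissible weight vector
(`cd_of_nested_simple_paths`).  Proof: the paths avoiding `a₂` form a `Finset` (Mathlib's
`SimpleGraph.Path.instFintype`); list them sorted by length (`List.mergeSort`); each dart of a path
comes from a unique edge (`openGraph_adj`, injectivity) — the darts of the `i`-th path, as triples
`(edge, fst, snd)`, are the route `L i`, chained (`isChain_dartAdj_darts`), hence walk-ordered from `a₁`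
(`CDNestedFan.walk_of_isChain`); its vertex set is the path's support; the sorting and `hchain` make the
supports nested (comparable sets whose cardinalities are ordered); every simple path avoiding `a₂` IS
one of the routes, so `CDNestedPaths.cd_of_nested_paths` applies.  No definition; one seat.
-/

namespace Summit.Ventures.PercRepro2

namespace CDNestedSimplePaths

section Theorem

variable {V : Type*} {E : Type*} [Fintype E] [DecidableEq E] [Fintype V] [DecidableEq V]
  {R : Type*} [Field R] [LinearOrder R] [IsStrictOrderedRing R]

/-- **THE NESTED-PATHS THEOREM.** In a finite simple graph whose simple `a₁–a₃` paths avoiding `a₂`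
have pairwise comparable vertex sets, row 2′CD holds at `(a₁, a₂, a₃, o)` for every `o`, every up-set
and every admissible weight vector. -/
theorem cd_of_nested_simple_paths (p : E → R) (hp : IsProbVec p) {ends : E → Sym2 V}
    (hinj : Function.Injective ends) {a₁ a₂ a₃ o : V} {𝓔 : Set (Set V)} (h𝓔 : IsUpperSet 𝓔)
    (hchain : ∀ P P' : (openGraph ends (fun _ => true)).Path a₁ a₃,
      a₂ ∉ P.1.support → a₂ ∉ P'.1.support →
      P.1.support.toFinset ⊆ P'.1.support.toFinset ∨ P'.1.support.toFinset ⊆ P.1.support.toFinset) :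
    let Q := (connEvent ends a₁ a₂)ᶜ
    let U := clusterInEvent ends a₁ 𝓔
    let e := connEvent ends a₁ a₃
    let f := connEvent ends a₂ o
    let N := (connEvent ends a₁ a₃)ᶜ ∩ (connEvent ends a₂ a₃)ᶜ
    let oU := connEvent ends a₁ o ∪ connEvent ends a₂ o
    prob p (Q ∩ N) * (prob p Q * prob p (Q ∩ U ∩ e ∩ f) - prob p (Q ∩ U) * prob p (Q ∩ e ∩ f)) ≤
      prob p (Q ∩ N ∩ oU) * (prob p Q * prob p (Q ∩ U ∩ e) - prob p (Q ∩ U) * prob p (Q ∩ e)) := by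
  classical
  -- every dart of the full graph comes from an edge
  have hdart : ∀ d : (openGraph ends (fun _ => true)).Dart, ∃ b : E, ends b = s(d.fst, d.snd) := by
    intro d
    obtain ⟨_, b, _, hb⟩ := openGraph_adj.1 d.adj
    exact ⟨b, hb⟩
  choose edgeOf hedgeOf using hdart
  -- the simple paths avoiding `a₂`, listed by increasing length
  set 𝓟 : Finset ((openGraph ends (fun _ => true)).Path a₁ a₃) :=
    Finset.univ.filter (fun P => a₂ ∉ P.1.support) with h𝓟
  set l : List ((openGraph ends (fun _ => true)).Path a₁ a₃) :=
    𝓟.toList.mergeSort (fun P P' => decide (P.1.length ≤ P'.1.length)) with hl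
  have hsorted : l.Pairwise (fun P P' => P.1.length ≤ P'.1.length) := by
    have := List.pairwise_mergeSort (le := fun P P' => decide (P.1.length ≤ P'.1.length))
      (fun a b c h₁ h₂ => by simpa using le_trans (by simpa using h₁) (by simpa using h₂))
      (fun a b => by simpa using le_total a.1.length b.1.length) 𝓟.toList
    simpa using this
  have hmem : ∀ P, P ∈ l ↔ a₂ ∉ P.1.support := by
    intro P
    rw [hl, (List.mergeSort_perm _ _).mem_iff, Finset.mem_toList, h𝓟, Finset.mem_filter]
    simp
  -- the routes: the darts of the `i`-th path as triples
  set L : ℕ → List (E × V × V) := fun i =>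
    if h : i < l.length then (l[i]'h).1.darts.map (fun d => (edgeOf d, d.fst, d.snd)) else [] with hL
  have hLi : ∀ i (h : i < l.length),
      L i = (l[i]'h).1.darts.map (fun d => (edgeOf d, d.fst, d.snd)) := by
    intro i h
    simp [hL, h]
  -- the vertex set of a route is the support of the path
  have hS : ∀ i (h : i < l.length),
      (L i).foldl (fun acc t => insert t.2.2 acc) ({a₁} : Finset V) = (l[i]'h).1.support.toFinset := by
    intro i h
    ext v
    rw [CDNestedFan.mem_foldl_insert_verts, hLi i h, List.mem_toFinset,
      SimpleGraph.Walk.mem_support_iff, ← SimpleGraph.Walk.map_snd_darts, List.mem_map,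
      Finset.mem_singleton]
    constructor
    · rintro (rfl | ⟨t, ht, rfl⟩)
      · exact Or.inl rfl
      · rw [List.mem_map] at ht
        obtain ⟨d, hd, rfl⟩ := ht
        exact Or.inr ⟨d, hd, rfl⟩
    · rintro (rfl | ⟨d, hd, rfl⟩)
      · exact Or.inl rfl
      · exact Or.inr ⟨(edgeOf d, d.fst, d.snd), List.mem_map.2 ⟨d, hd, rfl⟩, rfl⟩
  refine CDNestedPaths.cd_of_nested_paths p hp hinj l.length L
    (fun i => (L i).foldl (fun acc t => insert t.1 acc) ∅)
    (fun i => (L i).foldl (fun acc t => insert t.2.2 acc) {a₁}) (fun _ _ => rfl) (fun _ _ => rfl)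
    ?_ ?_ ?_ ?_ h𝓔 ?_
  · -- the ends of the route edges
    intro i hi t ht
    rw [hLi i hi, List.mem_map] at ht
    obtain ⟨d, _, rfl⟩ := ht
    exact hedgeOf d
  · -- walk-ordered from `a₁`: the darts are chained and the first starts at `a₁`
    intro i hi
    refine CDNestedFan.walk_of_isChain (L i) {a₁} ?_ ?_
    · intro t ht
      rw [hLi i hi] at ht
      rw [Finset.mem_singleton]
      have hsupp := SimpleGraph.Walk.map_fst_darts_append (l[i]'hi).1
      rw [← SimpleGraph.Walk.cons_tail_support] at hsupp
      rcases hd : (l[i]'hi).1.darts with _ | ⟨d, ds⟩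
      · rw [hd, List.map_nil, List.head?_nil] at ht
        exact (Option.not_mem_none t ht).elim
      · rw [hd] at ht hsupp
        simp only [List.map_cons, List.head?_cons, Option.mem_def, Option.some.injEq] at ht
        subst ht
        simp only [List.map_cons, List.cons_append, List.cons.injEq] at hsupp
        exact hsupp.1
    · rw [hLi i hi, List.isChain_map]
      refine (SimpleGraph.Walk.isChain_dartAdj_darts (l[i]'hi).1).imp ?_
      intro d d' hdd'
      exact hdd'.symm
  · -- every route reaches `a₃`
    intro i hi
    rw [hS i hi, List.mem_toFinset]
    exact SimpleGraph.Walk.end_mem_support _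
  · -- the vertex sets are nested along the sorted list
    intro j i hji hi
    have hj : j < l.length := lt_trans hji hi
    rw [hS j hj, hS i hi]
    have hPj : a₂ ∉ (l[j]'hj).1.support := (hmem _).1 (List.getElem_mem hj)
    have hPi : a₂ ∉ (l[i]'hi).1.support := (hmem _).1 (List.getElem_mem hi)
    have hlen : (l[j]'hj).1.length ≤ (l[i]'hi).1.length :=
      List.pairwise_iff_getElem.1 hsorted j i hj hi hji
    rcases hchain _ _ hPj hPi with h | h
    · exact h
    · -- the later path is inside the earlier one: equal cardinalities force equality
      have hcard : (l[i]'hi).1.support.toFinset.card ≤ (l[j]'hj).1.support.toFinset.card :=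
        Finset.card_le_card h
      rw [List.toFinset_card_of_nodup (l[i]'hi).2.support_nodup,
        List.toFinset_card_of_nodup (l[j]'hj).2.support_nodup, SimpleGraph.Walk.length_support,
        SimpleGraph.Walk.length_support] at hcard
      have heq : (l[i]'hi).1.support.toFinset = (l[j]'hj).1.support.toFinset := by
        refine Finset.eq_of_subset_of_card_le h ?_
        rw [List.toFinset_card_of_nodup (l[i]'hi).2.support_nodup,
          List.toFinset_card_of_nodup (l[j]'hj).2.support_nodup, SimpleGraph.Walk.length_support,
          SimpleGraph.Walk.length_support]
        omega
      rw [heq]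
  · -- every simple path avoiding `a₂` is one of the routes
    intro W hW ha₂
    have hWl : (⟨W, hW⟩ : (openGraph ends (fun _ => true)).Path a₁ a₃) ∈ l := (hmem _).2 ha₂
    obtain ⟨i, hi, hWi⟩ := List.mem_iff_getElem.1 hWl
    refine ⟨i, hi, fun b hb => ?_⟩
    rw [CDNestedInternal.mem_foldl_insert_edges, hLi i hi] at hb
    rcases hb with hb | ⟨t, ht, rfl⟩
    · exact absurd hb (Finset.notMem_empty b)
    · rw [List.mem_map] at ht
      obtain ⟨d, hd, rfl⟩ := ht
      rw [hWi] at hd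
      rw [hedgeOf d]
      simp only [SimpleGraph.Walk.edges, List.mem_map]
      exact ⟨d, hd, rfl⟩

end Theorem

end CDNestedSimplePaths

end Summit.Ventures.PercRepro2
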